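import Mathlib
import Summits.ValiantsHypothesis.ValiantsHypothesis.Theorems.TwoProducts.Negative.RankTwoEscapes
import Summits.ValiantsHypothesis.ValiantsHypothesis.Theorems.TwoProducts.Negative.CommonPadding
import Summits.ValiantsHypothesis.ValiantsHypothesis.Theorems.TwoProducts.Negative.RankTwoPadding
import Summits.ValiantsHypothesis.ValiantsHypothesis.Theorems.TwoProducts.Negative.RankTwoPaddingClassCover
import Summits.ValiantsHypothesis.ValiantsHypothesis.Theorems.TwoProducts.Negative.RankTwoPaddingMergeKit
import Summits.ValiantsHypothesis.ValiantsHypothesis.Theorems.TwoProducts.Negative.RankTwoPaddingBlockMerge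
import HarnessLib

/-!
# NEGATIVE lane (val-neg-1 g5): the v20 residual implies the v12 residual — rungs v13…v20 make no asymptotic progress on the residual

Helper file for crux `stmt-ValiantsHypothesis-5906` (filed `--supports`; closes NO item, proves NO summit statement, does NOT prove
`TwoProducts`, `PlanarCellBound` or VP ≠ VNP; 0 `def`s).

`residualV12_of_residualV20`: hypothesis = the text of `ResidualLawV20` of `Cruxes/TwoProducts/Lines/relation_ladder.lean` (v20) with the
Cruxes-only `def`s `ClassCover`, `FourTermRankOne`, `ThreeTermRankOne`, `ThreeTermAPRankOne`, `ThreeTermFreeRankOne`, `ThreeTermHomRankOne`,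
`ThreeTermGenRankOne`, `TwoTermRankOne` unfolded token-for-token (landed tokens `BlockSmall`, `mergeA`, `PermType`, `RankOneCoincidences`,
`IsCellFamily` by name); conclusion = the text of `ResidualLawV12` (same file), exponents `(a, b) ↦ (a, b + 2a)`.  So, as `∃ a b` laws,
`ResidualLawV20 ↔ ResidualLawV12` (the converse is the line's own `residualLawV14_of_V12 ∘ … ∘ residualLawV20_of_V19`): the seven rank-one
hatches R6/R7/R7♯/R7b/R7c excise NO asymptotic content from the residual in the presence of (R5) and (R1_r).

Mechanism (all landed, same seat): the COMMON DEEP PADDING of `Negative/RankTwoPadding.lean` with `N = m + 1` has no rank-one datum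
(`noDatum_padding_spec`), keeps every cell family, and RESPECTS both carried hypotheses — (R1_r) by `noCheapCover_padding`
(`Negative/RankTwoPaddingClassCover.lean`) and (R5) by `noSmallPermMerge_padding` (`Negative/RankTwoPaddingBlockMerge.lean`); the cost is
`m ↦ m + 4`, absorbed by `2^{4a} ≤ (t+2)^{2a}` (`t ≥ 2`).  Honest scope: this says nothing about the TRUTH of either residual (both are believed
open here); it says the v13…v20 hatches are not where the residual's difficulty lives.  [folklore]
-/

namespace Summit.ValiantsHypothesis.Theorems.TwoProducts.Negative.RankTwoPaddingResidual

open Finset MvPolynomial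
open Summit.ValiantsHypothesis.ValiantsHypothesis.Theorems.NewtonUnitEquations.TwoProducts.FormalLogLinearisation
open Summit.ValiantsHypothesis.ValiantsHypothesis.Theorems.NewtonUnitEquations.TwoProducts.PlanarCell
open Summit.ValiantsHypothesis.ValiantsHypothesis.Theorems.NewtonUnitEquations.TwoProducts.PermutationType
  (msetT PermType RankOneCoincidences)
open Summit.ValiantsHypothesis.Theorems.TwoProducts.Negative.CommonPadding
open Summit.ValiantsHypothesis.Theorems.TwoProducts.Negative.RankTwoPadding (noDatum_padding_spec)
open Summit.ValiantsHypothesis.Theorems.TwoProducts.Negative.RankTwoPaddingClassCover (noCheapCover_padding)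
open Summit.ValiantsHypothesis.Theorems.TwoProducts.Negative.RankTwoPaddingBlockMerge (noSmallPermMerge_padding)

/-- **`ResidualLawV20 (a, b) ⇒ ResidualLawV12 (a, b + 2a)`** (both inlined verbatim; see the module docstring). [folklore] -/
theorem residualV12_of_residualV20
    (h : ∃ a b : ℕ, ∀ (m t : ℕ), 2 ≤ t → ∀ (u v : Fin m → MvPolynomial (Fin 2) ℂ),
      (∀ j, coeff 0 (u j) = 0 ∧ (u j).support.card ≤ t) → (∀ j, coeff 0 (v j) = 0 ∧ (v j).support.card ≤ t) →
      (∀ (J : Finset (Fin m)) (j₀ : Fin m), j₀ ∈ J →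
        BlockSmall (fun j => (u j).support ∪ (v j).support) J (2 ^ m * (t + 2) ^ 4) →
        ¬ PermType (mergeA (fun j => (u j).support ∪ (v j).support) J j₀)) →
      (∀ (r : ℕ) (Jc : Fin r → Finset (Fin m)) (ac bc : Fin r → Fin m → Expo),
        (∀ a ∈ tuples (fun j => (u j).support ∪ (v j).support), ∀ b ∈ tuples (fun j => (u j).support ∪ (v j).support),
          a ≠ b → ∑ j, a j = ∑ j, b j →
          ∃ k : Fin r, (∀ j, a j ≠ b j ↔ j ∈ Jc k) ∧
            ((∀ j ∈ Jc k, a j = ac k j ∧ b j = bc k j) ∨ (∀ j ∈ Jc k, a j = bc k j ∧ b j = ac k j))) →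
        2 ^ m * (t + 2) ^ 4 < 2 * (m + 1) * (3 * (2 + m + m.choose 2) ^ 2) ^ r) →
      (¬ ∃ α β γ δ : Expo, α ≠ β ∧ α ≠ γ ∧ α ≠ δ ∧ β ≠ γ ∧ β ≠ δ ∧ γ ≠ δ ∧ α + β = γ + δ ∧
          RankOneCoincidences (fun j => (u j).support ∪ (v j).support) (Finsupp.single γ 1 + Finsupp.single δ 1)
            (Finsupp.single α 1 + Finsupp.single β 1)) →
      (¬ ∃ α β γ : Expo, α ≠ β ∧ α ≠ γ ∧ β ≠ γ ∧ α = β + γ ∧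
          RankOneCoincidences (fun j => (u j).support ∪ (v j).support) (Finsupp.single β 1 + Finsupp.single γ 1)
            (Finsupp.single α 1)) →
      (¬ ∃ α β γ : Expo, α ≠ β ∧ α ≠ γ ∧ β ≠ γ ∧ α + γ = β + β ∧
          RankOneCoincidences (fun j => (u j).support ∪ (v j).support) (Finsupp.single β 2)
            (Finsupp.single α 1 + Finsupp.single γ 1)) →
      (¬ ∃ (α β γ : Expo) (q r : ℕ), 1 ≤ q ∧ 1 ≤ r ∧ α ≠ β ∧ α ≠ γ ∧ β ≠ γ ∧ α = q • β + r • γ ∧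
          RankOneCoincidences (fun j => (u j).support ∪ (v j).support) (Finsupp.single β q + Finsupp.single γ r)
            (Finsupp.single α 1)) →
      (¬ ∃ α β γ : Expo, ∃ q r : ℕ, α ≠ β ∧ α ≠ γ ∧ β ≠ γ ∧ 1 ≤ q ∧ 1 ≤ r ∧ q • α + r • γ = (q + r) • β ∧
          RankOneCoincidences (fun j => (u j).support ∪ (v j).support) (Finsupp.single β (q + r))
            (Finsupp.single α q + Finsupp.single γ r)) →
      (¬ ∃ (α β γ : Expo) (p q r : ℕ), 1 ≤ p ∧ 1 ≤ q ∧ 1 ≤ r ∧ α ≠ β ∧ α ≠ γ ∧ β ≠ γ ∧ p • α = q • β + r • γ ∧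
          RankOneCoincidences (fun j => (u j).support ∪ (v j).support) (Finsupp.single β q + Finsupp.single γ r)
            (Finsupp.single α p)) →
      (¬ ∃ (α β : Expo) (p q : ℕ), 1 ≤ p ∧ 1 ≤ q ∧ α ≠ β ∧ p • α = q • β ∧
          RankOneCoincidences (fun j => (u j).support ∪ (v j).support) (Finsupp.single β q) (Finsupp.single α p)) →
      ∀ (R : Expo → Expo → Prop) (S : Finset Expo), IsCellFamily u v R S → S.card ≤ 2 ^ (a * m) * (t + 2) ^ b) :
    ∃ a b : ℕ, ∀ (m t : ℕ), 2 ≤ t → ∀ (u v : Fin m → MvPolynomial (Fin 2) ℂ),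
      (∀ j, coeff 0 (u j) = 0 ∧ (u j).support.card ≤ t) → (∀ j, coeff 0 (v j) = 0 ∧ (v j).support.card ≤ t) →
      (∀ (J : Finset (Fin m)) (j₀ : Fin m), j₀ ∈ J →
        BlockSmall (fun j => (u j).support ∪ (v j).support) J (2 ^ m * (t + 2) ^ 4) →
        ¬ PermType (mergeA (fun j => (u j).support ∪ (v j).support) J j₀)) →
      (∀ (r : ℕ) (Jc : Fin r → Finset (Fin m)) (ac bc : Fin r → Fin m → Expo),
        (∀ a ∈ tuples (fun j => (u j).support ∪ (v j).support), ∀ b ∈ tuples (fun j => (u j).support ∪ (v j).support),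
          a ≠ b → ∑ j, a j = ∑ j, b j →
          ∃ k : Fin r, (∀ j, a j ≠ b j ↔ j ∈ Jc k) ∧
            ((∀ j ∈ Jc k, a j = ac k j ∧ b j = bc k j) ∨ (∀ j ∈ Jc k, a j = bc k j ∧ b j = ac k j))) →
        2 ^ m * (t + 2) ^ 4 < 2 * (m + 1) * (3 * (2 + m + m.choose 2) ^ 2) ^ r) →
      ∀ (R : Expo → Expo → Prop) (S : Finset Expo), IsCellFamily u v R S → S.card ≤ 2 ^ (a * m) * (t + 2) ^ b := by
  obtain ⟨a, b, h⟩ := h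
  refine ⟨a, b + 2 * a, fun m t ht u v hu hv h10 hcc R S hS => ?_⟩
  rcases S.eq_empty_or_nonempty with rfl | hne
  · simp
  have hT := tailSupport_nonempty_of_isCellFamily hS hne
  have hu0 : ∀ j, coeff 0 (u j) = 0 := fun j => (hu j).1
  have hv0 : ∀ j, coeff 0 (v j) = 0 := fun j => (hv j).1
  -- the common deep padding with `N = m + 1`
  obtain ⟨hu', hv', -, -, -, hcell, -, hnod⟩ :=
    noDatum_padding_spec ht u v hu hv hT (N := m + 1) (by omega) _ rfl
  obtain ⟨R', hS'⟩ := hcell R S hS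
  have h10' := noSmallPermMerge_padding u v hu hv hT (N := m + 1) le_rfl _ rfl h10
  have hcc' := noCheapCover_padding u v hu0 hv0 hT (N := m + 1) (by omega) _ rfl hcc
  have hbound := h (m + 4) t ht _ _ hu' hv' h10' hcc' ?_ ?_ ?_ ?_ ?_ ?_ ?_ R' S hS'
  · have h16 : 2 ^ (a * (m + 4)) = 2 ^ (a * m) * 16 ^ a := by
      rw [mul_add, pow_add, show 2 ^ (a * 4) = 16 ^ a by rw [mul_comm, pow_mul]; norm_num]
    have h16le : 16 ^ a ≤ (t + 2) ^ (2 * a) := by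
      rw [pow_mul]
      exact Nat.pow_le_pow_left (by nlinarith) a
    calc S.card ≤ 2 ^ (a * (m + 4)) * (t + 2) ^ b := hbound
      _ = 2 ^ (a * m) * 16 ^ a * (t + 2) ^ b := by rw [h16]
      _ ≤ 2 ^ (a * m) * (t + 2) ^ (2 * a) * (t + 2) ^ b := Nat.mul_le_mul_right _ (Nat.mul_le_mul_left _ h16le)
      _ = 2 ^ (a * m) * (t + 2) ^ (b + 2 * a) := by rw [pow_add]; ring
  · rintro ⟨α, β, γ, δ, -, -, -, -, -, -, -, hR⟩; exact hnod _ _ hR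
  · rintro ⟨α, β, γ, -, -, -, -, hR⟩; exact hnod _ _ hR
  · rintro ⟨α, β, γ, -, -, -, -, hR⟩; exact hnod _ _ hR
  · rintro ⟨α, β, γ, q, r, -, -, -, -, -, -, hR⟩; exact hnod _ _ hR
  · rintro ⟨α, β, γ, q, r, -, -, -, -, -, -, hR⟩; exact hnod _ _ hR
  · rintro ⟨α, β, γ, p, q, r, -, -, -, -, -, -, -, hR⟩; exact hnod _ _ hR
  · rintro ⟨α, β, p, q, -, -, -, -, hR⟩; exact hnod _ _ hR

/-- The two residuals are EQUIVALENT as `∃ a b` laws (v12 ⇒ v20 drops the hatches). [folklore] -/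
theorem residualV20_iff_residualV12 :
    (∃ a b : ℕ, ∀ (m t : ℕ), 2 ≤ t → ∀ (u v : Fin m → MvPolynomial (Fin 2) ℂ),
      (∀ j, coeff 0 (u j) = 0 ∧ (u j).support.card ≤ t) → (∀ j, coeff 0 (v j) = 0 ∧ (v j).support.card ≤ t) →
      (∀ (J : Finset (Fin m)) (j₀ : Fin m), j₀ ∈ J →
        BlockSmall (fun j => (u j).support ∪ (v j).support) J (2 ^ m * (t + 2) ^ 4) →
        ¬ PermType (mergeA (fun j => (u j).support ∪ (v j).support) J j₀)) →
      (∀ (r : ℕ) (Jc : Fin r → Finset (Fin m)) (ac bc : Fin r → Fin m → Expo),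
        (∀ a ∈ tuples (fun j => (u j).support ∪ (v j).support), ∀ b ∈ tuples (fun j => (u j).support ∪ (v j).support),
          a ≠ b → ∑ j, a j = ∑ j, b j →
          ∃ k : Fin r, (∀ j, a j ≠ b j ↔ j ∈ Jc k) ∧
            ((∀ j ∈ Jc k, a j = ac k j ∧ b j = bc k j) ∨ (∀ j ∈ Jc k, a j = bc k j ∧ b j = ac k j))) →
        2 ^ m * (t + 2) ^ 4 < 2 * (m + 1) * (3 * (2 + m + m.choose 2) ^ 2) ^ r) →
      (¬ ∃ α β γ δ : Expo, α ≠ β ∧ α ≠ γ ∧ α ≠ δ ∧ β ≠ γ ∧ β ≠ δ ∧ γ ≠ δ ∧ α + β = γ + δ ∧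
          RankOneCoincidences (fun j => (u j).support ∪ (v j).support) (Finsupp.single γ 1 + Finsupp.single δ 1)
            (Finsupp.single α 1 + Finsupp.single β 1)) →
      (¬ ∃ α β γ : Expo, α ≠ β ∧ α ≠ γ ∧ β ≠ γ ∧ α = β + γ ∧
          RankOneCoincidences (fun j => (u j).support ∪ (v j).support) (Finsupp.single β 1 + Finsupp.single γ 1)
            (Finsupp.single α 1)) →
      (¬ ∃ α β γ : Expo, α ≠ β ∧ α ≠ γ ∧ β ≠ γ ∧ α + γ = β + β ∧
          RankOneCoincidences (fun j => (u j).support ∪ (v j).support) (Finsupp.single β 2)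
            (Finsupp.single α 1 + Finsupp.single γ 1)) →
      (¬ ∃ (α β γ : Expo) (q r : ℕ), 1 ≤ q ∧ 1 ≤ r ∧ α ≠ β ∧ α ≠ γ ∧ β ≠ γ ∧ α = q • β + r • γ ∧
          RankOneCoincidences (fun j => (u j).support ∪ (v j).support) (Finsupp.single β q + Finsupp.single γ r)
            (Finsupp.single α 1)) →
      (¬ ∃ α β γ : Expo, ∃ q r : ℕ, α ≠ β ∧ α ≠ γ ∧ β ≠ γ ∧ 1 ≤ q ∧ 1 ≤ r ∧ q • α + r • γ = (q + r) • β ∧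
          RankOneCoincidences (fun j => (u j).support ∪ (v j).support) (Finsupp.single β (q + r))
            (Finsupp.single α q + Finsupp.single γ r)) →
      (¬ ∃ (α β γ : Expo) (p q r : ℕ), 1 ≤ p ∧ 1 ≤ q ∧ 1 ≤ r ∧ α ≠ β ∧ α ≠ γ ∧ β ≠ γ ∧ p • α = q • β + r • γ ∧
          RankOneCoincidences (fun j => (u j).support ∪ (v j).support) (Finsupp.single β q + Finsupp.single γ r)
            (Finsupp.single α p)) →
      (¬ ∃ (α β : Expo) (p q : ℕ), 1 ≤ p ∧ 1 ≤ q ∧ α ≠ β ∧ p • α = q • β ∧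
          RankOneCoincidences (fun j => (u j).support ∪ (v j).support) (Finsupp.single β q) (Finsupp.single α p)) →
      ∀ (R : Expo → Expo → Prop) (S : Finset Expo), IsCellFamily u v R S → S.card ≤ 2 ^ (a * m) * (t + 2) ^ b) ↔
    (∃ a b : ℕ, ∀ (m t : ℕ), 2 ≤ t → ∀ (u v : Fin m → MvPolynomial (Fin 2) ℂ),
      (∀ j, coeff 0 (u j) = 0 ∧ (u j).support.card ≤ t) → (∀ j, coeff 0 (v j) = 0 ∧ (v j).support.card ≤ t) →
      (∀ (J : Finset (Fin m)) (j₀ : Fin m), j₀ ∈ J →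
        BlockSmall (fun j => (u j).support ∪ (v j).support) J (2 ^ m * (t + 2) ^ 4) →
        ¬ PermType (mergeA (fun j => (u j).support ∪ (v j).support) J j₀)) →
      (∀ (r : ℕ) (Jc : Fin r → Finset (Fin m)) (ac bc : Fin r → Fin m → Expo),
        (∀ a ∈ tuples (fun j => (u j).support ∪ (v j).support), ∀ b ∈ tuples (fun j => (u j).support ∪ (v j).support),
          a ≠ b → ∑ j, a j = ∑ j, b j →
          ∃ k : Fin r, (∀ j, a j ≠ b j ↔ j ∈ Jc k) ∧
            ((∀ j ∈ Jc k, a j = ac k j ∧ b j = bc k j) ∨ (∀ j ∈ Jc k, a j = bc k j ∧ b j = ac k j))) →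
        2 ^ m * (t + 2) ^ 4 < 2 * (m + 1) * (3 * (2 + m + m.choose 2) ^ 2) ^ r) →
      ∀ (R : Expo → Expo → Prop) (S : Finset Expo), IsCellFamily u v R S → S.card ≤ 2 ^ (a * m) * (t + 2) ^ b) :=
  ⟨residualV12_of_residualV20, fun ⟨a, b, h⟩ =>
    ⟨a, b, fun m t ht u v hu hv h10 hcc _ _ _ _ _ _ _ R S hS => h m t ht u v hu hv h10 hcc R S hS⟩⟩

/-- **`ResidualLawV21`-shape ⇒ `ResidualLawV12`**: the residual of the v21 CANDIDATE (val-lit-p3 g16, staged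
`lmr/staged/p3g16-R9/relation_ladder_v21_candidate.lean`: (R5) ∧ (R1_r) ∧ `¬ HasDatum`, with `HasDatum A := ∃ ρp ρm, RankOneCoincidences A ρp ρm`
unfolded) implies the v12 residual with `(a, b) ↦ (a, b + 2a)`: the ONE hatch «no rank-one datum at all» excises no asymptotic content either,
because the common deep padding (`N = m + 1`) has no datum and respects (R5)/(R1_r). [folklore] -/
theorem residualV12_of_residualNoDatum
    (h : ∃ a b : ℕ, ∀ (m t : ℕ), 2 ≤ t → ∀ (u v : Fin m → MvPolynomial (Fin 2) ℂ),
      (∀ j, coeff 0 (u j) = 0 ∧ (u j).support.card ≤ t) → (∀ j, coeff 0 (v j) = 0 ∧ (v j).support.card ≤ t) →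
      (∀ (J : Finset (Fin m)) (j₀ : Fin m), j₀ ∈ J →
        BlockSmall (fun j => (u j).support ∪ (v j).support) J (2 ^ m * (t + 2) ^ 4) →
        ¬ PermType (mergeA (fun j => (u j).support ∪ (v j).support) J j₀)) →
      (∀ (r : ℕ) (Jc : Fin r → Finset (Fin m)) (ac bc : Fin r → Fin m → Expo),
        (∀ a ∈ tuples (fun j => (u j).support ∪ (v j).support), ∀ b ∈ tuples (fun j => (u j).support ∪ (v j).support),
          a ≠ b → ∑ j, a j = ∑ j, b j →
          ∃ k : Fin r, (∀ j, a j ≠ b j ↔ j ∈ Jc k) ∧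
            ((∀ j ∈ Jc k, a j = ac k j ∧ b j = bc k j) ∨ (∀ j ∈ Jc k, a j = bc k j ∧ b j = ac k j))) →
        2 ^ m * (t + 2) ^ 4 < 2 * (m + 1) * (3 * (2 + m + m.choose 2) ^ 2) ^ r) →
      (¬ ∃ ρp ρm : Expo →₀ ℕ, RankOneCoincidences (fun j => (u j).support ∪ (v j).support) ρp ρm) →
      ∀ (R : Expo → Expo → Prop) (S : Finset Expo), IsCellFamily u v R S → S.card ≤ 2 ^ (a * m) * (t + 2) ^ b) :
    ∃ a b : ℕ, ∀ (m t : ℕ), 2 ≤ t → ∀ (u v : Fin m → MvPolynomial (Fin 2) ℂ),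
      (∀ j, coeff 0 (u j) = 0 ∧ (u j).support.card ≤ t) → (∀ j, coeff 0 (v j) = 0 ∧ (v j).support.card ≤ t) →
      (∀ (J : Finset (Fin m)) (j₀ : Fin m), j₀ ∈ J →
        BlockSmall (fun j => (u j).support ∪ (v j).support) J (2 ^ m * (t + 2) ^ 4) →
        ¬ PermType (mergeA (fun j => (u j).support ∪ (v j).support) J j₀)) →
      (∀ (r : ℕ) (Jc : Fin r → Finset (Fin m)) (ac bc : Fin r → Fin m → Expo),
        (∀ a ∈ tuples (fun j => (u j).support ∪ (v j).support), ∀ b ∈ tuples (fun j => (u j).support ∪ (v j).support),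
          a ≠ b → ∑ j, a j = ∑ j, b j →
          ∃ k : Fin r, (∀ j, a j ≠ b j ↔ j ∈ Jc k) ∧
            ((∀ j ∈ Jc k, a j = ac k j ∧ b j = bc k j) ∨ (∀ j ∈ Jc k, a j = bc k j ∧ b j = ac k j))) →
        2 ^ m * (t + 2) ^ 4 < 2 * (m + 1) * (3 * (2 + m + m.choose 2) ^ 2) ^ r) →
      ∀ (R : Expo → Expo → Prop) (S : Finset Expo), IsCellFamily u v R S → S.card ≤ 2 ^ (a * m) * (t + 2) ^ b := by
  obtain ⟨a, b, h⟩ := h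
  refine ⟨a, b + 2 * a, fun m t ht u v hu hv h10 hcc R S hS => ?_⟩
  rcases S.eq_empty_or_nonempty with rfl | hne
  · simp
  have hT := tailSupport_nonempty_of_isCellFamily hS hne
  have hu0 : ∀ j, coeff 0 (u j) = 0 := fun j => (hu j).1
  have hv0 : ∀ j, coeff 0 (v j) = 0 := fun j => (hv j).1
  obtain ⟨hu', hv', -, -, -, hcell, -, hnod⟩ :=
    noDatum_padding_spec ht u v hu hv hT (N := m + 1) (by omega) _ rfl
  obtain ⟨R', hS'⟩ := hcell R S hS
  have h10' := noSmallPermMerge_padding u v hu hv hT (N := m + 1) le_rfl _ rfl h10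
  have hcc' := noCheapCover_padding u v hu0 hv0 hT (N := m + 1) (by omega) _ rfl hcc
  have hbound := h (m + 4) t ht _ _ hu' hv' h10' hcc' (fun ⟨ρp, ρm, hR⟩ => hnod ρp ρm hR) R' S hS'
  have h16 : 2 ^ (a * (m + 4)) = 2 ^ (a * m) * 16 ^ a := by
    rw [mul_add, pow_add, show 2 ^ (a * 4) = 16 ^ a by rw [mul_comm, pow_mul]; norm_num]
  have h16le : 16 ^ a ≤ (t + 2) ^ (2 * a) := by
    rw [pow_mul]
    exact Nat.pow_le_pow_left (by nlinarith) a
  calc S.card ≤ 2 ^ (a * (m + 4)) * (t + 2) ^ b := hbound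
    _ = 2 ^ (a * m) * 16 ^ a * (t + 2) ^ b := by rw [h16]
    _ ≤ 2 ^ (a * m) * (t + 2) ^ (2 * a) * (t + 2) ^ b := Nat.mul_le_mul_right _ (Nat.mul_le_mul_left _ h16le)
    _ = 2 ^ (a * m) * (t + 2) ^ (b + 2 * a) := by rw [pow_add]; ring

/-- The v21-candidate residual and the v12 residual are EQUIVALENT as `∃ a b` laws. [folklore] -/
theorem residualNoDatum_iff_residualV12 :
    (∃ a b : ℕ, ∀ (m t : ℕ), 2 ≤ t → ∀ (u v : Fin m → MvPolynomial (Fin 2) ℂ),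
      (∀ j, coeff 0 (u j) = 0 ∧ (u j).support.card ≤ t) → (∀ j, coeff 0 (v j) = 0 ∧ (v j).support.card ≤ t) →
      (∀ (J : Finset (Fin m)) (j₀ : Fin m), j₀ ∈ J →
        BlockSmall (fun j => (u j).support ∪ (v j).support) J (2 ^ m * (t + 2) ^ 4) →
        ¬ PermType (mergeA (fun j => (u j).support ∪ (v j).support) J j₀)) →
      (∀ (r : ℕ) (Jc : Fin r → Finset (Fin m)) (ac bc : Fin r → Fin m → Expo),
        (∀ a ∈ tuples (fun j => (u j).support ∪ (v j).support), ∀ b ∈ tuples (fun j => (u j).support ∪ (v j).support),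
          a ≠ b → ∑ j, a j = ∑ j, b j →
          ∃ k : Fin r, (∀ j, a j ≠ b j ↔ j ∈ Jc k) ∧
            ((∀ j ∈ Jc k, a j = ac k j ∧ b j = bc k j) ∨ (∀ j ∈ Jc k, a j = bc k j ∧ b j = ac k j))) →
        2 ^ m * (t + 2) ^ 4 < 2 * (m + 1) * (3 * (2 + m + m.choose 2) ^ 2) ^ r) →
      (¬ ∃ ρp ρm : Expo →₀ ℕ, RankOneCoincidences (fun j => (u j).support ∪ (v j).support) ρp ρm) →
      ∀ (R : Expo → Expo → Prop) (S : Finset Expo), IsCellFamily u v R S → S.card ≤ 2 ^ (a * m) * (t + 2) ^ b) ↔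
    (∃ a b : ℕ, ∀ (m t : ℕ), 2 ≤ t → ∀ (u v : Fin m → MvPolynomial (Fin 2) ℂ),
      (∀ j, coeff 0 (u j) = 0 ∧ (u j).support.card ≤ t) → (∀ j, coeff 0 (v j) = 0 ∧ (v j).support.card ≤ t) →
      (∀ (J : Finset (Fin m)) (j₀ : Fin m), j₀ ∈ J →
        BlockSmall (fun j => (u j).support ∪ (v j).support) J (2 ^ m * (t + 2) ^ 4) →
        ¬ PermType (mergeA (fun j => (u j).support ∪ (v j).support) J j₀)) →
      (∀ (r : ℕ) (Jc : Fin r → Finset (Fin m)) (ac bc : Fin r → Fin m → Expo),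
        (∀ a ∈ tuples (fun j => (u j).support ∪ (v j).support), ∀ b ∈ tuples (fun j => (u j).support ∪ (v j).support),
          a ≠ b → ∑ j, a j = ∑ j, b j →
          ∃ k : Fin r, (∀ j, a j ≠ b j ↔ j ∈ Jc k) ∧
            ((∀ j ∈ Jc k, a j = ac k j ∧ b j = bc k j) ∨ (∀ j ∈ Jc k, a j = bc k j ∧ b j = ac k j))) →
        2 ^ m * (t + 2) ^ 4 < 2 * (m + 1) * (3 * (2 + m + m.choose 2) ^ 2) ^ r) →
      ∀ (R : Expo → Expo → Prop) (S : Finset Expo), IsCellFamily u v R S → S.card ≤ 2 ^ (a * m) * (t + 2) ^ b) :=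
  ⟨residualV12_of_residualNoDatum, fun ⟨a, b, h⟩ =>
    ⟨a, b, fun m t ht u v hu hv h10 hcc _ R S hS => h m t ht u v hu hv h10 hcc R S hS⟩⟩

end Summit.ValiantsHypothesis.Theorems.TwoProducts.Negative.RankTwoPaddingResidual
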